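import Literature.MathematicalPhysics.QuantumLattice.AnisotropicSectorSupport
import Mathlib.Analysis.SpecialFunctions.SmoothTransition
import Mathlib.MeasureTheory.Measure.Lebesgue.EqHaar
import Mathlib.MeasureTheory.Integral.Bochner.Basic
import Mathlib.Analysis.Real.Pi.Bounds
import HarnessLib

/-!
# The single-scale sector propagator: definition and the dimensional bound `|g^{(h)}_ω(x)| ≤ Cγ^{3h/2}`
(Benfatto–Giuliani–Mastropietro 2006, Lemma 2.2, order zero)

Topic `Literature/MathematicalPhysics/QuantumLattice`; continues `AnisotropicSectors.lean`
(`F_{h,ω} = anisotropicCutoff e₀ μ n ω`, scale `h = -n`, `γ = 4`) and `AnisotropicSectorSupport.lean`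
(the sector box `|k'₁| ≤ B₁ = O(γ^h)`, `|k'₂| ≤ B₂ = O(γ^{h/2})` on the support, for momenta in the
disc `|k⃗| ≤ π/2`).

BGM 2006, §2.5 (2.49)–(2.50) and Lemma 2.2 (2.52): the single-scale sector propagator
`g^{(h)}_ω(x) = ∫ dk e^{ikx} F_{h,ω}(k) / (-ik₀ + E_h(k⃗) - μ)` obeys
`|g^{(h)}_ω(x)| ≤ C_N γ^{(3/2)h} (1 + (γ^h|x₀| + γ^h|x'₁|)^N + γ^{hN/2}|x'₂|^N)^{-1}`; the order-zero
case is the statement that the support of `F_{h,ω}` has volume `O(γ^h · γ^h · γ^{h/2})` while on it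
`|-ik₀ + E_h - μ| ≥ e₀γ^{h-2}`. This file PROVES that order-zero case (`N = 0`, the dimensional
bound) for the continuum-in-`k₀` (formal zero-temperature / infinite-volume) propagator with the
dispersion `E_h ≡ ε` fixed (as in `ScaleCutoffs.lean`) and the momentum integral restricted to
the central copy of the `2πℤ²`-periodic shell by a smooth zone bump:

* `zoneBump` — a smooth radial bump `χ(k⃗) ∈ [0,1]`, `χ = 1` for `|k⃗|² ≤ 2`, `χ = 0` for
  `|k⃗| ≥ π/2` (on the support of `χ` the sector geometry of `AnisotropicSectorSupport` applies; that
  the central copy of the shell lies in `|k⃗|² ≤ 2` when `e₀ ≤ (4+μ)/2`, so that `χ = 1` on it, is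
  elementary and is not needed for the bound);
* `sectorDenom μ (k₀, k⃗) = -ik₀ + (ε(k⃗) - μ)`, `‖sectorDenom‖ = √(k₀² + (ε-μ)²)`;
* `sectorSymbol e₀ μ n ω = F_{h,ω} χ / sectorDenom`, with `‖sectorSymbol‖ ≤ (e₀γ^{h-2})⁻¹` (on the
  shell `|D| > e₀γ^{h-2}`, `scaleCutoffFn_ne_zero`) and support in the slab `|k₀| ≤ e₀γ^h` times the
  sector box (`sectorSymbol_ne_zero`);
* `volume_sectorBox_le` — the sector box `{|k'₁| ≤ B₁, |k'₂| ≤ B₂}` has Lebesgue measure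
  `≤ 2B₁ · 2B₂` (an isometric affine image of a rectangle: the frame `(n, τ)` is orthonormal with
  `det = 1`);
* `sectorPropagator e₀ μ n ω x₀ x⃗ = ∫ e^{i(k⃗·x⃗ - k₀x₀)} sectorSymbol` and
  **`norm_sectorPropagator_le`**: `|g^{(h)}_ω(x)| ≤ 128 · B₁(n) B₂(n)` uniformly in `x` and `ω`, where
  `B₁(n) = O(4^{-n}) = O(γ^h)`, `B₂(n) = O(2^{-n}) = O(γ^{h/2})` are the sides of the sector box
  (`normalExtent`, `tangentExtent`); hence `|g^{(h)}_ω(x)| ≤ C(μ, e₀) 4^{-n} 2^{-n} = Cγ^{(3/2)h}`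
  (`exists_norm_sectorPropagator_le`).

Everything is PROVED; the definitions are the bump, the denominator, the symbol, the extents, the
box and the propagator.

## Sources

* G. Benfatto, A. Giuliani, V. Mastropietro, Ann. Henri Poincaré 7 (2006) 809–898, §2.5
  (2.46)–(2.52), Lemma 2.2 (arXiv:cond-mat/0507686 pp. 10–11). [BenfattoGiulianiMastropietro2006]
* G. Benfatto, A. Giuliani, V. Mastropietro, Ann. Henri Poincaré 4 (2003) 137–193, Lemma 3.1 and
  §7.2 (its proof). [BenfattoGiulianiMastropietro2003]
-/

noncomputable section

open Real Set MeasureTheory Complex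
open scoped Topology ENNReal

namespace Literature.MathematicalPhysics.QuantumLattice

/-! ### The zone bump -/

/-- A smooth radial bump selecting the central copy of the shell: `χ(k⃗) = S((π²/4 - |k⃗|²)/(π²/4 - 2))`
with `S = Real.smoothTransition`. [folklore] -/
def zoneBump (k : Fin 2 → ℝ) : ℝ :=
  Real.smoothTransition ((π ^ 2 / 4 - (k 0 ^ 2 + k 1 ^ 2)) / (π ^ 2 / 4 - 2))

/-- `π²/4 > 2`. [folklore] -/
theorem two_lt_pi_sq_div_four : (2 : ℝ) < π ^ 2 / 4 := by
  have := Real.pi_gt_three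
  nlinarith

/-- `0 ≤ χ ≤ 1`. [folklore] -/
theorem zoneBump_mem_Icc (k : Fin 2 → ℝ) : zoneBump k ∈ Icc (0 : ℝ) 1 :=
  ⟨Real.smoothTransition.nonneg _, Real.smoothTransition.le_one _⟩

/-- `χ = 1` on `|k⃗|² ≤ 2`. [folklore] -/
theorem zoneBump_eq_one {k : Fin 2 → ℝ} (hk : k 0 ^ 2 + k 1 ^ 2 ≤ 2) : zoneBump k = 1 := by
  refine Real.smoothTransition.one_of_one_le ?_
  rw [le_div_iff₀ (by linarith [two_lt_pi_sq_div_four]), one_mul]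
  linarith

/-- `χ = 0` off the open disc `|k⃗| < π/2`. [folklore] -/
theorem zoneBump_eq_zero {k : Fin 2 → ℝ} (hk : π ^ 2 / 4 ≤ k 0 ^ 2 + k 1 ^ 2) : zoneBump k = 0 :=
  Real.smoothTransition.zero_of_nonpos (div_nonpos_of_nonpos_of_nonneg (by linarith)
    (by linarith [two_lt_pi_sq_div_four]))

/-- On the support of `χ`, `|k⃗| ≤ π/2`. [folklore] -/
theorem norm_le_of_zoneBump_ne_zero {k : Fin 2 → ℝ} (h : zoneBump k ≠ 0) : ‖momToComplex k‖ ≤ π / 2 := by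
  have hlt : k 0 ^ 2 + k 1 ^ 2 < π ^ 2 / 4 := by
    by_contra hc
    exact h (zoneBump_eq_zero (not_lt.1 hc))
  have hsq : ‖momToComplex k‖ ^ 2 ≤ (π / 2) ^ 2 := by
    rw [norm_momToComplex_sq]; nlinarith
  exact (pow_le_pow_iff_left₀ (norm_nonneg _) (by positivity) two_ne_zero).1 hsq

/-- `χ` is smooth. [folklore] -/
theorem contDiff_zoneBump {m : ℕ∞} : ContDiff ℝ m zoneBump := by
  unfold zoneBump
  refine Real.smoothTransition.contDiff.comp ?_
  exact (contDiff_const.sub (((contDiff_apply ℝ ℝ 0).pow 2).add ((contDiff_apply ℝ ℝ 1).pow 2))).div_const _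

/-! ### The denominator and the symbol -/

/-- The denominator `D(k₀, k⃗) = -ik₀ + (ε(k⃗) - μ)` of BGM 2006 (2.49) (with `E_h ≡ ε`). [cite: BenfattoGiulianiMastropietro2006, §2.5 (2.49)] -/
def sectorDenom (μ : ℝ) (p : ℝ × (Fin 2 → ℝ)) : ℂ :=
  -(Complex.I * (p.1 : ℂ)) + ((sqDispersion p.2 - μ : ℝ) : ℂ)

/-- `‖D‖ = √(k₀² + (ε-μ)²)`. [folklore] -/
theorem norm_sectorDenom (μ : ℝ) (p : ℝ × (Fin 2 → ℝ)) :
    ‖sectorDenom μ p‖ = Real.sqrt (p.1 ^ 2 + (sqDispersion p.2 - μ) ^ 2) := by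
  rw [sectorDenom, Complex.norm_eq_sqrt_sq_add_sq]
  congr 1
  simp only [Complex.add_re, Complex.neg_re, Complex.mul_re, Complex.I_re, Complex.ofReal_re,
    Complex.I_im, Complex.ofReal_im, Complex.add_im, Complex.neg_im, Complex.mul_im]
  ring

/-- **The single-scale sector symbol** `F_{h,ω}(k) χ(k⃗) / (-ik₀ + ε(k⃗) - μ)` (BGM 2006 (2.49),
restricted to the central copy of the shell). [cite: BenfattoGiulianiMastropietro2006, §2.5 (2.49)] -/
def sectorSymbol (e₀ μ : ℝ) (n : ℕ) (ω : ℤ) (p : ℝ × (Fin 2 → ℝ)) : ℂ :=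
  ((anisotropicCutoff e₀ μ n ω p * zoneBump p.2 : ℝ) : ℂ) / sectorDenom μ p

/-- **On the shell the denominator is of order `γ^h`; the symbol is `O(γ^{-h})`**:
`‖sectorSymbol‖ ≤ (e₀ 4^{-n-2})⁻¹`. [cite: BenfattoGiulianiMastropietro2006, §2.5 (2.49)–(2.50)] -/
theorem norm_sectorSymbol_le {e₀ μ : ℝ} (he : 0 < e₀) (n : ℕ) (ω : ℤ) (p : ℝ × (Fin 2 → ℝ)) :
    ‖sectorSymbol e₀ μ n ω p‖ ≤ (e₀ * (4 : ℝ) ^ (-(n : ℤ) - 2))⁻¹ := by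
  have hlow : 0 < e₀ * (4 : ℝ) ^ (-(n : ℤ) - 2) := mul_pos he (zpow_pos (by norm_num) _)
  by_cases hF : anisotropicCutoff e₀ μ n ω p = 0
  · simp only [sectorSymbol, hF, zero_mul, Complex.ofReal_zero, zero_div, norm_zero]
    exact inv_nonneg.2 hlow.le
  · have hD := (anisotropicCutoff_ne_zero_scale he hF).1
    rw [← norm_sectorDenom] at hD
    have hnum : ‖((anisotropicCutoff e₀ μ n ω p * zoneBump p.2 : ℝ) : ℂ)‖ ≤ 1 := by
      rw [Complex.norm_real, Real.norm_eq_abs, abs_of_nonneg (mul_nonneg (anisotropicCutoff_mem_Icc he n ω p).1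
        (zoneBump_mem_Icc p.2).1)]
      exact mul_le_one₀ (anisotropicCutoff_mem_Icc he n ω p).2 (zoneBump_mem_Icc p.2).1 (zoneBump_mem_Icc p.2).2
    rw [sectorSymbol, norm_div]
    calc _ ≤ 1 / ‖sectorDenom μ p‖ := div_le_div_of_nonneg_right hnum (norm_nonneg _)
      _ ≤ 1 / (e₀ * (4 : ℝ) ^ (-(n : ℤ) - 2)) := one_div_le_one_div_of_le hlow hD.le
      _ = _ := one_div _

/-! ### The sector box and its volume -/

section Box

variable {μ : ℝ} (hμ₁ : -4 < μ) (hμ₂ : μ < -2 - Real.sqrt 2)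
include hμ₁ hμ₂

omit hμ₁ hμ₂ in
/-- The sector box `{k⃗ : |k'₁| ≤ B₁, |k'₂| ≤ B₂}` in the frame at `θ₀`. [cite: BenfattoGiulianiMastropietro2006, §2.5 (2.46)] -/
def sectorBox (μ θ₀ B₁ B₂ : ℝ) : Set (Fin 2 → ℝ) :=
  {k | |normalCoord μ θ₀ k| ≤ B₁ ∧ |tangentCoord μ θ₀ k| ≤ B₂}

omit hμ₁ hμ₂ in
/-- The frame matrix with columns `n(θ₀)`, `τ(θ₀)`. [folklore] -/
def fermiFrameMatrix (μ θ₀ : ℝ) : Matrix (Fin 2) (Fin 2) ℝ :=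
  !![fermiNormal μ θ₀ 0, fermiTangent μ θ₀ 0; fermiNormal μ θ₀ 1, fermiTangent μ θ₀ 1]

/-- The frame is orthonormal and positively oriented: `det = 1`. [folklore] -/
theorem det_fermiFrameMatrix (θ₀ : ℝ) : (fermiFrameMatrix μ θ₀).det = 1 := by
  have hs := fermiSpeed_pos hμ₁ hμ₂ θ₀
  have hsq := fermiSpeed_sq μ θ₀
  rw [fermiFrameMatrix, Matrix.det_fin_two_of]
  simp only [fermiNormal, fermiTangent, Pi.smul_apply, smul_eq_mul, Matrix.cons_val_zero, Matrix.cons_val_one]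
  field_simp
  linarith

omit hμ₁ hμ₂ in
/-- The frame map sends `(a, b)` to `a n + b τ`. [folklore] -/
theorem fermiFrameMatrix_mulVec (θ₀ : ℝ) (c : Fin 2 → ℝ) :
    (fermiFrameMatrix μ θ₀).mulVec c = c 0 • fermiNormal μ θ₀ + c 1 • fermiTangent μ θ₀ := by
  ext i
  fin_cases i <;> simp [fermiFrameMatrix, Matrix.mulVec, dotProduct, Fin.sum_univ_two, mul_comm]

/-- **The sector box is contained in the translate by `p_F(θ₀)` of the frame image of the rectangle
`[-B₁, B₁] × [-B₂, B₂]`** (the sector decomposition (2.46)). [cite: BenfattoGiulianiMastropietro2006, §2.5 (2.46)] -/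
theorem sectorBox_subset (θ₀ B₁ B₂ : ℝ) :
    sectorBox μ θ₀ B₁ B₂ ⊆ (fun k => k + -![fermiX μ θ₀, fermiY μ θ₀]) ⁻¹'
      (Matrix.toLin' (fermiFrameMatrix μ θ₀) '' Icc ![-B₁, -B₂] ![B₁, B₂]) := by
  intro k hk
  rw [mem_preimage]
  refine ⟨![normalCoord μ θ₀ k, tangentCoord μ θ₀ k], ?_, ?_⟩
  · simp only [mem_Icc]
    constructor
    · intro i; fin_cases i
      · simpa using (abs_le.1 hk.1).1
      · simpa using (abs_le.1 hk.2).1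
    · intro i; fin_cases i
      · simpa using (abs_le.1 hk.1).2
      · simpa using (abs_le.1 hk.2).2
  · rw [Matrix.toLin'_apply, fermiFrameMatrix_mulVec]
    have hdec := sector_decomposition hμ₁ hμ₂ θ₀ k
    rw [fermiRadius_smul_dir_eq] at hdec
    simp only [Matrix.cons_val_zero, Matrix.cons_val_one]
    conv_rhs => rw [hdec]
    abel

/-- **The sector box has measure at most `2B₁ · 2B₂`.** [cite: BenfattoGiulianiMastropietro2006, §2.5 Lemma 2.2] -/
theorem volume_sectorBox_le (θ₀ : ℝ) (B₁ B₂ : ℝ) :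
    volume (sectorBox μ θ₀ B₁ B₂) ≤ ENNReal.ofReal (2 * B₁) * ENNReal.ofReal (2 * B₂) := by
  refine (measure_mono (sectorBox_subset hμ₁ hμ₂ θ₀ B₁ B₂)).trans ?_
  rw [measure_preimage_add_right, MeasureTheory.Measure.addHaar_image_linearMap volume, LinearMap.det_toLin',
    det_fermiFrameMatrix hμ₁ hμ₂, abs_one, ENNReal.ofReal_one, one_mul, Real.volume_Icc_pi, Fin.prod_univ_two]
  simp only [Matrix.cons_val_zero, Matrix.cons_val_one]
  rw [show B₁ - -B₁ = 2 * B₁ by ring, show B₂ - -B₂ = 2 * B₂ by ring]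

end Box

/-! ### The support of the symbol -/

section Support

variable {μ : ℝ} (hμ₁ : -4 < μ) (hμ₂ : μ < -2 - Real.sqrt 2)
include hμ₁ hμ₂

omit hμ₁ hμ₂ in
/-- The normal extent `B₁(n) = C_r e₀ γ^h + C_n (¾ w_n)²` of the sector box (`= O(γ^h)`). [cite: BenfattoGiulianiMastropietro2006, §2.5 (2.47)] -/
def normalExtent (μ e₀ : ℝ) (n : ℕ) : ℝ :=
  π / (4 * Real.sqrt ((4 + μ) / 2)) * (e₀ * (4 : ℝ) ^ (-(n : ℤ))) +
    2 * accelBound μ * Real.sqrt (π ^ 2 / 8 + (4 * π ^ 3 / (μ + 4)) ^ 2) / Real.sqrt (μ + 4) *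
      (3 * sectorWidth n / 4) ^ 2

omit hμ₁ hμ₂ in
/-- The tangential extent `B₂(n) = C_r e₀ γ^h + C_t (¾ w_n)` of the sector box (`= O(γ^{h/2})`). [cite: BenfattoGiulianiMastropietro2006, §2.5 (2.47)] -/
def tangentExtent (μ e₀ : ℝ) (n : ℕ) : ℝ :=
  π / (4 * Real.sqrt ((4 + μ) / 2)) * (e₀ * (4 : ℝ) ^ (-(n : ℤ))) +
    2 * Real.sqrt (π ^ 2 / 8 + (4 * π ^ 3 / (μ + 4)) ^ 2) * (3 * sectorWidth n / 4)

/-- `0 ≤ B₁`. [folklore] -/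
theorem normalExtent_nonneg {e₀ : ℝ} (he : 0 < e₀) (n : ℕ) : 0 ≤ normalExtent μ e₀ n := by
  have hA : 0 ≤ accelBound μ := (abs_nonneg _).trans (abs_fermiAX_le hμ₁ hμ₂ 0)
  have h4 : 0 < 4 + μ := by linarith
  have h4' : 0 < μ + 4 := by linarith
  have hw := sectorWidth_pos n
  unfold normalExtent
  positivity

omit hμ₂ in
/-- `0 ≤ B₂`. [folklore] -/
theorem tangentExtent_nonneg {e₀ : ℝ} (he : 0 < e₀) (n : ℕ) : 0 ≤ tangentExtent μ e₀ n := by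
  have h4 : 0 < 4 + μ := by linarith
  have hw := sectorWidth_pos n
  unfold tangentExtent
  positivity

/-- **The support of the symbol**: if `sectorSymbol(k₀, k⃗) ≠ 0` then `|k₀| ≤ e₀ 4^{-n}` and `k⃗`
lies in the sector box at `θ_{h,ω} = (ω + ½) w_n` with sides `B₁(n)`, `B₂(n)`. [cite: BenfattoGiulianiMastropietro2006, §2.5 (2.46)–(2.47)] -/
theorem sectorSymbol_ne_zero {e₀ : ℝ} (he : 0 < e₀) (he' : e₀ ≤ (4 + μ) / 2) {n : ℕ} {ω : ℤ}
    {p : ℝ × (Fin 2 → ℝ)} (h : sectorSymbol e₀ μ n ω p ≠ 0) :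
    p.1 ∈ Icc (-(e₀ * (4 : ℝ) ^ (-(n : ℤ)))) (e₀ * (4 : ℝ) ^ (-(n : ℤ))) ∧
      p.2 ∈ sectorBox μ (((ω : ℝ) + 1 / 2) * sectorWidth n) (normalExtent μ e₀ n) (tangentExtent μ e₀ n) := by
  have hnum : anisotropicCutoff e₀ μ n ω p * zoneBump p.2 ≠ 0 := by
    intro h0
    apply h
    rw [sectorSymbol, h0, Complex.ofReal_zero, zero_div]
  have hF : anisotropicCutoff e₀ μ n ω (p.1, p.2) ≠ 0 := left_ne_zero_of_mul hnum
  have hχ : zoneBump p.2 ≠ 0 := right_ne_zero_of_mul hnum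
  have hk := norm_le_of_zoneBump_ne_zero hχ
  refine ⟨?_, abs_normalCoord_le_of_ne_zero hμ₁ hμ₂ he he' hk hF, abs_tangentCoord_le_of_ne_zero hμ₁ hμ₂ he he' hk hF⟩
  -- `|k₀| ≤ √(k₀² + (ε-μ)²) < e₀ 4^{-n}`
  have hsc := (anisotropicCutoff_ne_zero_scale he hF).2
  have hk0 : |p.1| ≤ Real.sqrt (p.1 ^ 2 + (sqDispersion p.2 - μ) ^ 2) := by
    rw [← Real.sqrt_sq_eq_abs]
    exact Real.sqrt_le_sqrt (by nlinarith)
  exact abs_le.1 (hk0.trans hsc.le)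

end Support

/-! ### The propagator and the dimensional bound -/

section Propagator

/-- **The single-scale sector propagator** (BGM 2006 (2.49), continuum in `k₀`, central copy of
the shell): `g^{(h)}_ω(x₀, x⃗) = ∫ e^{i(k⃗·x⃗ - k₀x₀)} F_{h,ω}(k) χ(k⃗) / (-ik₀ + ε(k⃗) - μ) dk₀ dk⃗`.
[cite: BenfattoGiulianiMastropietro2006, §2.5 (2.49)] -/
def sectorPropagator (e₀ μ : ℝ) (n : ℕ) (ω : ℤ) (x₀ : ℝ) (x : Fin 2 → ℝ) : ℂ :=
  ∫ p : ℝ × (Fin 2 → ℝ), Complex.exp (((p.2 0 * x 0 + p.2 1 * x 1 - p.1 * x₀ : ℝ) : ℂ) * Complex.I) *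
    sectorSymbol e₀ μ n ω p

variable {μ : ℝ} (hμ₁ : -4 < μ) (hμ₂ : μ < -2 - Real.sqrt 2)
include hμ₁ hμ₂

/-- **The dimensional bound `|g^{(h)}_ω(x)| ≤ Cγ^{3h/2}`** (BGM 2006 (2.50)/(2.52) at order zero): for
`0 < e₀ ≤ (4+μ)/2` and all `n, ω, x`,
`‖sectorPropagator‖ ≤ (e₀ 4^{-n-2})⁻¹ · 2e₀4^{-n} · 2B₁(n) · 2B₂(n) = 128 B₁(n) B₂(n)`
(sup of the symbol times the volume of its support). [cite: BenfattoGiulianiMastropietro2006, §2.5 Lemma 2.2 (2.52)] -/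
theorem norm_sectorPropagator_le {e₀ : ℝ} (he : 0 < e₀) (he' : e₀ ≤ (4 + μ) / 2) (n : ℕ) (ω : ℤ)
    (x₀ : ℝ) (x : Fin 2 → ℝ) :
    ‖sectorPropagator e₀ μ n ω x₀ x‖ ≤ 128 * (normalExtent μ e₀ n * tangentExtent μ e₀ n) := by
  set θ₀ : ℝ := ((ω : ℝ) + 1 / 2) * sectorWidth n with hθ₀
  set a : ℝ := e₀ * (4 : ℝ) ^ (-(n : ℤ)) with ha
  set B₁ := normalExtent μ e₀ n with hB₁
  set B₂ := tangentExtent μ e₀ n with hB₂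
  have ha0 : 0 < a := mul_pos he (zpow_pos (by norm_num) _)
  have hB₁0 : 0 ≤ B₁ := normalExtent_nonneg hμ₁ hμ₂ he n
  have hB₂0 : 0 ≤ B₂ := tangentExtent_nonneg hμ₁ he n
  set M : ℝ := (e₀ * (4 : ℝ) ^ (-(n : ℤ) - 2))⁻¹ with hM
  have hM0 : 0 ≤ M := by rw [hM]; exact inv_nonneg.2 (mul_pos he (zpow_pos (by norm_num) _)).le
  set T : Set (ℝ × (Fin 2 → ℝ)) := Icc (-a) a ×ˢ sectorBox μ θ₀ B₁ B₂ with hT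
  set f : ℝ × (Fin 2 → ℝ) → ℂ := fun p =>
    Complex.exp (((p.2 0 * x 0 + p.2 1 * x 1 - p.1 * x₀ : ℝ) : ℂ) * Complex.I) * sectorSymbol e₀ μ n ω p with hf
  -- the integrand is bounded by `M` and vanishes off `T`
  have hfM : ∀ p, ‖f p‖ ≤ M := fun p => by
    rw [hf]
    simp only [norm_mul, Complex.norm_exp_ofReal_mul_I, one_mul]
    exact norm_sectorSymbol_le he n ω p
  have hfT : ∀ p, p ∉ T → f p = 0 := by
    intro p hp
    by_contra hne
    have hS : sectorSymbol e₀ μ n ω p ≠ 0 := right_ne_zero_of_mul hne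
    obtain ⟨h1, h2⟩ := sectorSymbol_ne_zero hμ₁ hμ₂ he he' hS
    exact hp (mk_mem_prod h1 h2)
  -- the volume of `T`
  have hvol : volume T ≤ ENNReal.ofReal (2 * a) * (ENNReal.ofReal (2 * B₁) * ENNReal.ofReal (2 * B₂)) := by
    rw [hT, MeasureTheory.Measure.volume_eq_prod, Measure.prod_prod, Real.volume_Icc, show a - -a = 2 * a by ring]
    gcongr
    exact volume_sectorBox_le hμ₁ hμ₂ θ₀ B₁ B₂
  have hvolT : volume T < ⊤ := lt_of_le_of_lt hvol (by
    refine ENNReal.mul_lt_top ENNReal.ofReal_lt_top (ENNReal.mul_lt_top ENNReal.ofReal_lt_top ENNReal.ofReal_lt_top))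
  have hvolR : (volume T).toReal ≤ 2 * a * (2 * B₁ * (2 * B₂)) := by
    have := ENNReal.toReal_mono (by
      refine ENNReal.mul_ne_top ENNReal.ofReal_ne_top (ENNReal.mul_ne_top ENNReal.ofReal_ne_top ENNReal.ofReal_ne_top)) hvol
    rwa [ENNReal.toReal_mul, ENNReal.toReal_mul, ENNReal.toReal_ofReal (by positivity),
      ENNReal.toReal_ofReal (by positivity), ENNReal.toReal_ofReal (by positivity)] at this
  -- the estimate
  calc ‖sectorPropagator e₀ μ n ω x₀ x‖ = ‖∫ p, f p‖ := rfl
    _ = ‖∫ p in T, f p‖ := by rw [setIntegral_eq_integral_of_forall_compl_eq_zero hfT]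
    _ ≤ M * (volume T).toReal := norm_setIntegral_le_of_norm_le_const hvolT fun p _ => hfM p
    _ ≤ M * (2 * a * (2 * B₁ * (2 * B₂))) := mul_le_mul_of_nonneg_left hvolR hM0
    _ = 128 * (B₁ * B₂) := by
        rw [hM, ha, zpow_sub₀ (by norm_num : (4 : ℝ) ≠ 0)]
        field_simp
        ring

/-- **`|g^{(h)}_ω(x)| ≤ C γ^{(3/2)h}`** with `C` depending on `μ, e₀` only: the extents satisfy
`B₁(n) ≤ c₁ 4^{-n}` and `B₂(n) ≤ c₂ 2^{-n}` (`w_n = π 2^{-n}`, `w_n² = π² 4^{-n}`, `4^{-n} ≤ 2^{-n}`).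
[cite: BenfattoGiulianiMastropietro2006, §2.5 Lemma 2.2 (2.52)] -/
theorem exists_norm_sectorPropagator_le {e₀ : ℝ} (he : 0 < e₀) (he' : e₀ ≤ (4 + μ) / 2) :
    ∃ C : ℝ, 0 ≤ C ∧ ∀ (n : ℕ) (ω : ℤ) (x₀ : ℝ) (x : Fin 2 → ℝ),
      ‖sectorPropagator e₀ μ n ω x₀ x‖ ≤ C * ((4 : ℝ) ^ (-(n : ℤ)) * (2 : ℝ) ^ (-(n : ℤ))) := by
  have hA : 0 ≤ accelBound μ := (abs_nonneg _).trans (abs_fermiAX_le hμ₁ hμ₂ 0)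
  have h4 : 0 < 4 + μ := by linarith
  have h4' : 0 < μ + 4 := by linarith
  -- the constants
  set Cr : ℝ := π / (4 * Real.sqrt ((4 + μ) / 2)) * e₀ with hCr
  set Cn : ℝ := 2 * accelBound μ * Real.sqrt (π ^ 2 / 8 + (4 * π ^ 3 / (μ + 4)) ^ 2) / Real.sqrt (μ + 4) with hCn
  set Ct : ℝ := 2 * Real.sqrt (π ^ 2 / 8 + (4 * π ^ 3 / (μ + 4)) ^ 2) with hCt
  have hCr0 : 0 ≤ Cr := by positivity
  have hCn0 : 0 ≤ Cn := by positivity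
  have hCt0 : 0 ≤ Ct := by positivity
  set c₁ : ℝ := Cr + Cn * (9 / 16 * π ^ 2) with hc₁
  set c₂ : ℝ := Cr + Ct * (3 / 4 * π) with hc₂
  refine ⟨128 * (c₁ * c₂), by positivity, fun n ω x₀ x => ?_⟩
  have hw : sectorWidth n = π * (2 : ℝ) ^ (-(n : ℤ)) := by
    rw [sectorWidth, zpow_neg, zpow_natCast, div_eq_mul_inv]
  have h42 : (4 : ℝ) ^ (-(n : ℤ)) = ((2 : ℝ) ^ (-(n : ℤ))) ^ 2 := by
    rw [← zpow_natCast, ← zpow_mul, show (4 : ℝ) = 2 ^ (2 : ℤ) by norm_num, ← zpow_mul]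
    congr 1; ring
  have h2pos : 0 < (2 : ℝ) ^ (-(n : ℤ)) := zpow_pos (by norm_num) _
  have h2le : (2 : ℝ) ^ (-(n : ℤ)) ≤ 1 := zpow_le_one_of_nonpos₀ (by norm_num) (by simp)
  have h4le2 : (4 : ℝ) ^ (-(n : ℤ)) ≤ (2 : ℝ) ^ (-(n : ℤ)) := by
    rw [h42, sq]; exact mul_le_of_le_one_left h2pos.le h2le
  have h4pos : 0 < (4 : ℝ) ^ (-(n : ℤ)) := zpow_pos (by norm_num) _
  -- `B₁ ≤ c₁ 4^{-n}`, `B₂ ≤ c₂ 2^{-n}`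
  have hB₁ : normalExtent μ e₀ n ≤ c₁ * (4 : ℝ) ^ (-(n : ℤ)) := by
    have : normalExtent μ e₀ n = Cr * (4 : ℝ) ^ (-(n : ℤ)) + Cn * (9 / 16 * π ^ 2) * (4 : ℝ) ^ (-(n : ℤ)) := by
      rw [normalExtent, hw, hCr, hCn, h42]; ring
    rw [this, hc₁]; ring_nf; rfl
  have hB₂ : tangentExtent μ e₀ n ≤ c₂ * (2 : ℝ) ^ (-(n : ℤ)) := by
    have : tangentExtent μ e₀ n = Cr * (4 : ℝ) ^ (-(n : ℤ)) + Ct * (3 / 4 * π) * (2 : ℝ) ^ (-(n : ℤ)) := by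
      rw [tangentExtent, hw, hCr, hCt]; ring
    rw [this, hc₂, add_mul]
    exact add_le_add (mul_le_mul_of_nonneg_left h4le2 hCr0) le_rfl
  have hB₁0 : 0 ≤ normalExtent μ e₀ n := normalExtent_nonneg hμ₁ hμ₂ he n
  have hB₂0 : 0 ≤ tangentExtent μ e₀ n := tangentExtent_nonneg hμ₁ he n
  calc ‖sectorPropagator e₀ μ n ω x₀ x‖ ≤ 128 * (normalExtent μ e₀ n * tangentExtent μ e₀ n) :=
        norm_sectorPropagator_le hμ₁ hμ₂ he he' n ω x₀ x
    _ ≤ 128 * ((c₁ * (4 : ℝ) ^ (-(n : ℤ))) * (c₂ * (2 : ℝ) ^ (-(n : ℤ)))) :=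
        mul_le_mul_of_nonneg_left (mul_le_mul hB₁ hB₂ hB₂0 (by positivity)) (by norm_num)
    _ = 128 * (c₁ * c₂) * ((4 : ℝ) ^ (-(n : ℤ)) * (2 : ℝ) ^ (-(n : ℤ))) := by ring

end Propagator

end Literature.MathematicalPhysics.QuantumLattice

end
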